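import Summits.Ventures.HSemireg.Pad4TowerXInfA

/-!
# Venture HSemireg — PAD-4: THEOREM X∞ in the kernel, part B1 — admissible configurations, partners of fully charged cells, and the
# steps (B1), (B2), (B4)+(B5) of LEMMA X∞-B ((F1ℝ) slice, alphabet 𝒰 unbounded, no universe list, no `decide`)

HONEST FRAMING. Lean index of the computation cell `pub-hsemireg` (S4-PUSH, H2 door PAD-4); seat `hodge-semireg-assembly-p1`
(director-hodge g8 l.30592). Source: bc5-plan g4 memo `BC5-PLAN-g4-MEMO.md` v4.1 df3e4f41db3c2fcf — **THEOREM X∞ (pencil ×1 at typing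
time; LEG A ∕ LEG B referee reads routed, not yet delivered)**. `Pad4TowerXInfA` proved §2 (LEMMA X∞-A) and the first sentence of §3
(COROLLARY A′). THIS FILE and its sequel `Pad4TowerXInf` (split by the 400-line cap) prove §3's second sentence, §4 (LEMMA X∞-B,
steps (B1)–(B6)) and §5 (THEOREM X∞) — so that, ON THE (F1ℝ) SLICE and in the memo's own typed vocabulary (§6: `InUscr`, `PSC`,
`XClean`, bundled here as `Admissible`), **THEOREM X∞ IS A KERNEL THEOREM** (`Pad4TowerXInf`: `Admissible.three_O : Admissible C →
∀ X ∈ C, 3 ≤ X.key.count (0,0)` («junk») and `xinf_muC_eq_zero` — a design with admissible support has `μ = 0`, i.e. violates (H1);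
NO Ψ-row). THIS FILE: through (B5). What remains pencil is what is pencil everywhere in this directory: the
(E1)-meaning of RULE D (§1′) and of X-cleanness (LEMMA X-PHASE at general depth, §22 REMARK (2) — LEG A's object), and the reduction
«G-invariant ⇒ PSC». The kernel proof follows the memo step by step; the places where the typed argument is SHARPER than the prose
are recorded in the docstrings ((B5): the server `N′` dies by «an N with two rays has no unit ray», no tower form needed; (B6): the
two-tower step uses the all-tower property of every fully charged N).

CONTENT (this file §1–§4; `Pad4TowerXInf` §5–§6). §1 `Admissible`; `FC`; `Admissible.atMostOne` (= COROLLARY A′); `Admissible.fc_of_agree` (§3 second sentence: a cell of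
the configuration agreeing with a fully charged cell on two whole factors is fully charged — so legs, servers and covers of fully
charged cells are fully charged); letters of `𝒰` (`not_two_two`, `ray_or_tower`, side bookkeeping). §2 `Admissible.two_le_ray`
((R-N): an N with two rays has ray charges ≥ 2). §3 (B1) `Admissible.b1_lower` ∕ `Admissible.b1`: an all-tower fully charged world
is empty (least top coordinate; `Finset.exists_min_image`). §4 (B2) `b2_upper` ∕ `b2_lower`, `antiServer` ((B4)'s RULE-D step),
`b45` ((B4)+(B5)). §5 `no_big_ray` ((B3)–(B5): no ray of the maximal charge when it is ≥ 2), `allTower_of_unit` ((B6)), `no_fc`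
(LEMMA X∞-B: largest ray charge by `Finset.exists_max_image`, three cases). §6 `Admissible.three_O` (THEOREM X∞), `xinf_muC_eq_zero`.

WHAT IS NOT HERE ∕ NOT IN LEAN. The (E1)∕(H2) semantics (pencil); μ₄ phases `±i` (the memo: «the (F1ℝ) slice is a faithful
restriction … except the ONE sibling in §2 (N_c), which in (F1ℝ) is the swap»); modes∕sections; the reduction of G-invariance to
PSC; the finite universes as instances (they are `Pad4TowerUniverse*`). Nothing is a statement about a variety, a sheaf, σ, a seed
or an abelian variety; NOTHING HERE SAYS THAT HC ∕ HC_CM ∕ HC_AV ∕ W₆ ∕ HC_Kum4Type HOLDS OR FAILS. One `structure` (`Admissible`, a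
`Prop` bundle of the four hypotheses), no `instance`, no notation, no named fact, 0 `sorry`; axioms standard.

SOURCES (sha16): BC5-PLAN-g4-MEMO.md v4.1 df3e4f41db3c2fcf §0–§6, §10; director-hodge g8 cell INBOX l.30592 (the typed target);
census entry 5 adca5a601d927b9f (X-collapse, the finite shadow); `Pad4TowerLemmaT.lean` bfb2cc0a1a90b649 (RULE D,
`servedBelow_of_zero`); `Pad4TowerXInfA` (this seat).
-/

namespace Summit.Ventures.HSemireg.Pad4Tower

open Finset

/-! ## §1 Admissible configurations; fully charged cells; partners of fully charged cells -/

/-- the hypotheses of THEOREM X∞ (memo v4.1 §6): cells in `𝒰` on both levels, RULE-D-closed, PSC, X-clean. -/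
structure Admissible (C : Config) : Prop where
  /-- `N`-cells in `𝒰` -/
  uN : ∀ Z ∈ C.lower, InUscr Z
  /-- `P`-cells in `𝒰` -/
  uP : ∀ P ∈ C.upper, InUscr P
  /-- RULE D on both levels -/
  ruleD : RuleDClosed C
  /-- phase-sibling closure at O-carrying `N`-cells -/
  psc : PSC C
  /-- no `N`-cell meets the apex-vertex X-PHASE instance -/
  xclean : XClean C

/-- FULLY CHARGED: no O-factor. -/
abbrev FC (X : Cell) : Prop := ∀ f, ¬ isO X f

/-- COROLLARY A′ in use: in an admissible configuration a cell (either level) with an O-factor has at most one charged factor. -/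
theorem Admissible.atMostOne {C : Config} (hA : Admissible C) {X : Cell} (hX : X ∈ C.lower ∨ X ∈ C.upper) {f j k : Fin 4}
    (hO : isO X f) (hjf : j ≠ f) (hkf : k ≠ f) (hjk : j ≠ k) (hj : ¬ isO X j) (hk : ¬ isO X k) : False := by
  rcases hX with h | h
  · exact no_O_biCharged_N hA.ruleD hA.psc hA.xclean hA.uP hA.uN h hO hjf hkf hjk hj hk
  · exact no_O_biCharged_P hA.ruleD hA.psc hA.xclean hA.uP hA.uN h hO hjf hkf hjk hj hk

/-- **partners of fully charged cells are fully charged** (memo §3, second sentence): a cell of the configuration agreeing with a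
fully charged cell on two whole factors is fully charged. -/
theorem Admissible.fc_of_agree {C : Config} (hA : Admissible C) {X Y : Cell} (hY : Y ∈ C.lower ∨ Y ∈ C.upper) (hX : FC X)
    {a b : Fin 4} (hab : a ≠ b) (ha : ∀ r, Y a r = X a r) (hb : ∀ r, Y b r = X b r) : FC Y := by
  intro f hf
  have haO : ¬ isO Y a := fun h => hX a ⟨by rw [← ha]; exact h.1, by rw [← ha]; exact h.2⟩
  have hbO : ¬ isO Y b := fun h => hX b ⟨by rw [← hb]; exact h.1, by rw [← hb]; exact h.2⟩
  have haf : a ≠ f := fun h => haO (h ▸ hf)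
  have hbf : b ≠ f := fun h => hbO (h ▸ hf)
  exact hA.atMostOne hY hf haf hbf hab haO hbO

/-- in `𝒰` no letter has both coordinates `≥ 2`. -/
theorem not_two_two {X : Cell} (hU : InUscr X) {j : Fin 4} (h0 : 2 ≤ X j 0) (h1 : 2 ≤ X j 1) : False := by
  rcases hU j with h | h | ⟨hmin, -⟩
  · omega
  · omega
  · have := le_min h0 h1; omega

/-- both coordinates of a factor from the two sides `v`, `v.rev`. -/
theorem two_le_both {X : Cell} {j : Fin 4} {v : Fin 2} (hv : 2 ≤ X j v) (hv' : 2 ≤ X j v.rev) : 2 ≤ X j 0 ∧ 2 ≤ X j 1 := by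
  constructor
  · rcases (show (0 : Fin 2) = v ∨ (0 : Fin 2) = v.rev by fin_cases v <;> decide) with h | h <;> rw [h] <;> assumption
  · rcases (show (1 : Fin 2) = v ∨ (1 : Fin 2) = v.rev by fin_cases v <;> decide) with h | h <;> rw [h] <;> assumption

/-- a fully charged factor of a cell of `𝒰` is a pure ray (one side `0`) or a tower (one side `= 1`, the other `≥ 2`). -/
theorem ray_or_tower {X : Cell} (hU : InUscr X) (hX : FC X) (j : Fin 4) :
    (∃ u : Fin 2, X j u ≠ 0 ∧ X j u.rev = 0) ∨ (∃ u : Fin 2, 2 ≤ X j u ∧ X j u.rev = 1) := by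
  rcases hU j with h | h | ⟨hmin, hmax⟩
  · exact Or.inl ⟨1, fun h1 => hX j ⟨h, h1⟩, h⟩
  · exact Or.inl ⟨0, fun h0 => hX j ⟨h0, h⟩, h⟩
  · right
    rcases le_total (X j 0) (X j 1) with hle | hle
    · exact ⟨1, by rw [max_eq_right hle] at hmax; exact hmax, by rw [min_eq_left hle] at hmin; exact hmin⟩
    · exact ⟨0, by rw [max_eq_left hle] at hmax; exact hmax, by rw [min_eq_right hle] at hmin; exact hmin⟩

/-! ## §2 (R-N)-type facts for fully charged `N`-cells -/

/-- **an `N`-cell with two ray factors has all ray charges `≥ 2`** (memo (B2): «an N with ≥ 2 ray factors has every ray charge ≥ 2»: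
the zero coordinate of one ray makes the own coordinate of the other served below — `servedBelow_of_zero` — and a leg down to `0`
would be a cell with an O-letter charged on two factors). -/
theorem Admissible.two_le_ray {C : Config} (hA : Admissible C) {N : Cell} (hN : N ∈ C.lower) (hfc : FC N) {k k' : Fin 4}
    (hkk : k ≠ k') {u u' : Fin 2} (hk : N k u.rev = 0) (hk'1 : N k' u' ≠ 0) (hk'0 : N k' u'.rev = 0) : 2 ≤ N k' u' := by
  obtain ⟨P, hPu, hag, hlt⟩ := servedBelow_of_zero C (hA.ruleD.1 N hN) hk (Ne.symm hkk) hk'1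
  obtain ⟨a, haf, -⟩ := exists_fourth k' k' k'
  obtain ⟨b, hbf, -, hba⟩ := exists_fourth k' k' a
  have hPfc : FC P := hA.fc_of_agree (Or.inr hPu) hfc (Ne.symm hba) (fun r => hag a r (fun h => haf h.1))
    (fun r => hag b r (fun h => hbf h.1))
  have hP1 : P k' u' ≠ 0 := fun h0 =>
    hPfc k' (by
      have h1 : P k' u'.rev = 0 := by rw [hag k' u'.rev (fun h => absurd h.2 (by fin_cases u' <;> decide))]; exact hk'0
      exact ⟨by rcases (show (0 : Fin 2) = u' ∨ (0 : Fin 2) = u'.rev by fin_cases u' <;> decide) with h | h <;> rw [h] <;>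
        assumption, by rcases (show (1 : Fin 2) = u' ∨ (1 : Fin 2) = u'.rev by fin_cases u' <;> decide) with h | h <;>
        rw [h] <;> assumption⟩)
  omega

/-- the larger side bounds the maximum of the two coordinates. -/
theorem max_le_side {X : Cell} {i : Fin 4} {u : Fin 2} (h : X i u.rev ≤ X i u) : max (X i 0) (X i 1) ≤ X i u := by
  apply max_le
  · rcases (show (0 : Fin 2) = u ∨ (0 : Fin 2) = u.rev by fin_cases u <;> decide) with e | e <;> rw [e]; exact h
  · rcases (show (1 : Fin 2) = u ∨ (1 : Fin 2) = u.rev by fin_cases u <;> decide) with e | e <;> rw [e]; exact h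

/-- a side value is at most the maximum. -/
theorem side_le_max (X : Cell) (i : Fin 4) (u : Fin 2) : X i u ≤ max (X i 0) (X i 1) := by
  fin_cases u
  · exact le_max_left _ _
  · exact le_max_right _ _

/-- the maximum of the two coordinates, read from side `u`. -/
theorem max_sides (X : Cell) (i : Fin 4) (u : Fin 2) : max (X i 0) (X i 1) = max (X i u) (X i u.rev) := by
  fin_cases u
  · rfl
  · exact max_comm _ _

/-! ## §3 (B1): an all-tower fully charged world is empty (least tower charge descends) -/

section B1
variable {C : Config} (hA : Admissible C)
  (hall : ∀ X, (X ∈ C.lower ∨ X ∈ C.upper) → FC X → ∀ i r, X i r ≠ 0)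
include hA hall

/-- in an all-tower world every fully charged factor is a tower: a side `u` with value `≥ 2`, the other side `= 1`. -/
theorem Admissible.towerAt {X : Cell} (hX : X ∈ C.lower ∨ X ∈ C.upper) (hfc : FC X) (i : Fin 4) :
    ∃ u : Fin 2, 2 ≤ X i u ∧ X i u.rev = 1 := by
  have hU : InUscr X := hX.elim (hA.uN X) (hA.uP X)
  rcases ray_or_tower hU hfc i with ⟨u, -, h0⟩ | h
  · exact (hall X hX hfc i u.rev h0).elim
  · exact h

/-- (B1), `N`-cells: no fully charged `N`-cell carries a tower of LEAST top coordinate among all towers of the fully charged world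
(RULE D against another tower's unserved `1`: the own coordinate is served below by a smaller tower — a unit ray or a bare node
being excluded). -/
theorem Admissible.b1_lower {N : Cell} (hN : N ∈ C.lower) (hfc : FC N) {i : Fin 4} {u : Fin 2} (hu : 2 ≤ N i u) (hu' : N i u.rev = 1)
    (hmin : ∀ Y, (Y ∈ C.lower ∨ Y ∈ C.upper) → FC Y → ∀ i', N i u ≤ max (Y i' 0) (Y i' 1)) : False := by
  obtain ⟨k, hki, -⟩ := exists_fourth i i i
  obtain ⟨w, -, hw'⟩ := hA.towerAt hall (Or.inl hN) hfc k
  obtain ⟨a, hai, hak, -⟩ := exists_fourth i k k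
  obtain ⟨b, hbi, hbk, hba⟩ := exists_fourth i k a
  rcases hA.ruleD.1 N hN i k (Ne.symm hki) u w.rev (by omega) with ⟨P, hPu, hag, hlt⟩ | ⟨P, hPu, hag, hlt⟩ |
      ⟨P, hPu, hag, -, hlt⟩
  · have hPfc : FC P := hA.fc_of_agree (Or.inr hPu) hfc (Ne.symm hak) (fun r => hag k r (fun h => hki h.1))
      (fun r => hag a r (fun h => hai h.1))
    have h1 : P i u.rev = 1 := by rw [hag i u.rev (fun h => absurd h.2 (by fin_cases u <;> decide))]; exact hu'
    have := hmin P (Or.inr hPu) hPfc i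
    rw [max_sides P i u, h1] at this
    omega
  · have hPfc : FC P := hA.fc_of_agree (Or.inr hPu) hfc (Ne.symm hai) (fun r => hag i r (fun h => hki.symm h.1))
      (fun r => hag a r (fun h => hak h.1))
    exact hall P (Or.inr hPu) hPfc k w.rev (by omega)
  · have hPfc : FC P := hA.fc_of_agree (Or.inr hPu) hfc (Ne.symm hba) (fun r => hag a r (fun h => hai h.1) (fun h => hak h.1))
      (fun r => hag b r (fun h => hbi h.1) (fun h => hbk h.1))
    exact hall P (Or.inr hPu) hPfc k w.rev (by omega)

/-- **(B1)**: in an admissible configuration whose fully charged cells have no zero coordinate (all letters towers), there is NO fully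
charged cell. (Least top coordinate of a tower: at an `N` it descends by `b1_lower`; at a `P` RULE D against another tower's `1`
gives an own-up server `N` carrying the same least tower — raising the `1` would leave `𝒰`.) -/
theorem Admissible.b1 : ∀ X, (X ∈ C.lower ∨ X ∈ C.upper) → ¬ FC X := by
  intro X₀ hX₀ hfc₀
  set D : Finset (Cell × Fin 4) := ((C.lower ∪ C.upper).filter fun X => FC X) ×ˢ (univ : Finset (Fin 4)) with hD
  have hmemD : ∀ Y i, (Y, i) ∈ D ↔ (Y ∈ C.lower ∨ Y ∈ C.upper) ∧ FC Y := fun Y i => by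
    simp [hD, Finset.mem_product, Finset.mem_filter, Finset.mem_union]
  obtain ⟨⟨X, i⟩, hXD, hmin⟩ := Finset.exists_min_image D (fun p : Cell × Fin 4 => max (p.1 p.2 0) (p.1 p.2 1))
    ⟨(X₀, 0), (hmemD X₀ 0).2 ⟨hX₀, hfc₀⟩⟩
  obtain ⟨hX, hfc⟩ := (hmemD X i).1 hXD
  obtain ⟨u, hu, hu'⟩ := hA.towerAt hall hX hfc i
  have hXmax : max (X i 0) (X i 1) = X i u := le_antisymm (max_le_side (by omega)) (side_le_max X i u)
  have hmin' : ∀ Y, (Y ∈ C.lower ∨ Y ∈ C.upper) → FC Y → ∀ i', X i u ≤ max (Y i' 0) (Y i' 1) := fun Y hY hYfc i' => by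
    have := hmin (Y, i') ((hmemD Y i').2 ⟨hY, hYfc⟩); rw [hXmax] at this; exact this
  rcases hX with hXl | hXu
  · exact hA.b1_lower hall hXl hfc hu hu' hmin'
  · obtain ⟨j, hji, -⟩ := exists_fourth i i i
    obtain ⟨v, hv, hv'⟩ := hA.towerAt hall (Or.inr hXu) hfc j
    obtain ⟨a, hai, haj, -⟩ := exists_fourth i j j
    obtain ⟨b, hbi, hbj, hba⟩ := exists_fourth i j a
    rcases hA.ruleD.2 X hXu j i hji v u.rev (by omega) with ⟨N, hNl, hag, hlt⟩ | ⟨N, hNl, hag, hlt⟩ | ⟨N, hNl, hag, -, hlt⟩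
    · have hNi : ∀ r, N i r = X i r := fun r => hag i r (fun h => hji.symm h.1)
      have hNfc : FC N := hA.fc_of_agree (Or.inl hNl) hfc hai.symm hNi (fun r => hag a r (fun h => haj h.1))
      exact hA.b1_lower hall hNl hNfc (i := i) (u := u) (by rw [hNi]; exact hu) (by rw [hNi]; exact hu')
        (fun Y hY hYfc i' => by rw [hNi]; exact hmin' Y hY hYfc i')
    · exact not_two_two (hA.uN N hNl) (two_le_both (v := u) (by rw [hag i u (fun h => absurd h.2 (by fin_cases u <;> decide))]; exact hu) (by omega)).1 (two_le_both (v := u) (by rw [hag i u (fun h => absurd h.2 (by fin_cases u <;> decide))]; exact hu) (by omega)).2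
    · exact not_two_two (hA.uN N hNl) (two_le_both (v := u) (by rw [hag i u (fun h => hji.symm h.1) (fun h => absurd h.2 (by fin_cases u <;> decide))]; exact hu) (by omega)).1 (two_le_both (v := u) (by rw [hag i u (fun h => hji.symm h.1) (fun h => absurd h.2 (by fin_cases u <;> decide))]; exact hu) (by omega)).2

end B1

/-- the minimum of the two coordinates, read from side `u`. -/
theorem min_sides (X : Cell) (i : Fin 4) (u : Fin 2) : min (X i 0) (X i 1) = min (X i u) (X i u.rev) := by
  fin_cases u
  · rfl
  · exact min_comm _ _

/-- a coordinate value transported to the numbered sides. -/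
theorem side_cases {X : Cell} {i : Fin 4} (u : Fin 2) {p : ℕ → Prop} (h0 : p (X i 0)) (h1 : p (X i 1)) : p (X i u) := by
  fin_cases u
  · exact h0
  · exact h1

/-- both sides zero ⇒ O-factor. -/
theorem isO_of_sides {X : Cell} {m : Fin 4} (t : Fin 2) (h : X m t = 0) (h' : X m t.rev = 0) : isO X m := by
  constructor
  · rcases (show (0 : Fin 2) = t ∨ (0 : Fin 2) = t.rev by fin_cases t <;> decide) with e | e <;> rw [e] <;> assumption
  · rcases (show (1 : Fin 2) = t ∨ (1 : Fin 2) = t.rev by fin_cases t <;> decide) with e | e <;> rw [e] <;> assumption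

/-- the numbered sides in terms of a side `t` and its opposite. -/
theorem side01 (t : Fin 2) : ((0 : Fin 2) = t ∨ (0 : Fin 2) = t.rev) ∧ ((1 : Fin 2) = t ∨ (1 : Fin 2) = t.rev) := by
  fin_cases t <;> decide

/-- a side is not its opposite. -/
theorem ne_rev (t : Fin 2) : t ≠ t.rev := by fin_cases t <;> decide

/-! ## §4 (B2)–(B5): no ray of charge `≥ 2` in the fully charged world -/

section B25
variable {C : Config} (hA : Admissible C) {R : ℕ}
  (hR : ∀ Y, (Y ∈ C.lower ∨ Y ∈ C.upper) → FC Y → ∀ k t, Y k t.rev = 0 → Y k t ≤ R)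
include hA hR

/-- (B2), `P`-side: a fully charged `P`-cell with a tower cannot carry a ray of the maximal charge `R ≥ 2` (RULE D at (ray `R`,
tower's `1`): the own-up server would carry a ray of charge `> R`; raising the `1` leaves `𝒰`). -/
theorem Admissible.b2_upper (h2 : 2 ≤ R) {P : Cell} (hPu : P ∈ C.upper) (hfc : FC P) {j k : Fin 4} (hjk : j ≠ k) {v u : Fin 2}
    (hjv : 2 ≤ P j v) (hjv' : P j v.rev = 1) (hku : P k u = R) (hku' : P k u.rev = 0) : False := by
  obtain ⟨a, haj, hak, -⟩ := exists_fourth j k k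
  rcases hA.ruleD.2 P hPu k j hjk.symm u v.rev (by omega) with ⟨N, hNl, hag, hlt⟩ | ⟨N, hNl, hag, hlt⟩ | ⟨N, hNl, hag, -, hlt⟩
  · have hNfc : FC N :=
      hA.fc_of_agree (Or.inl hNl) hfc (Ne.symm haj) (fun r => hag j r (fun h => hjk h.1)) (fun r => hag a r (fun h => hak h.1))
    have := hR N (Or.inl hNl) hNfc k u (by rw [hag k u.rev (fun h => absurd h.2 (by fin_cases u <;> decide))]; exact hku')
    omega
  · have hv : N j v = P j v := hag j v (fun h => absurd h.2 (by fin_cases v <;> decide))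
    have hb := two_le_both (X := N) (j := j) (v := v) (by omega) (by omega)
    exact not_two_two (hA.uN N hNl) hb.1 hb.2
  · have hv : N j v = P j v := hag j v (fun h => hjk h.1) (fun h => absurd h.2 (by fin_cases v <;> decide))
    have hb := two_le_both (X := N) (j := j) (v := v) (by omega) (by omega)
    exact not_two_two (hA.uN N hNl) hb.1 hb.2

/-- (B2), `N`-side: a fully charged `N`-cell with two towers cannot carry a ray of the maximal charge `R ≥ 2` (its zero coordinate makes
a tower's `1` served below; the leg is a `P` with the other tower and the ray `R`). -/
theorem Admissible.b2_lower (h2 : 2 ≤ R) {N : Cell} (hN : N ∈ C.lower) (hfc : FC N) {j j' k : Fin 4} (hjk : j ≠ k) (hj'k : j' ≠ k)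
    (hjj' : j ≠ j') {v v' u : Fin 2} (hjv1 : N j v.rev = 1) (hj'v : 2 ≤ N j' v') (hj'v1 : N j' v'.rev = 1)
    (hku : N k u = R) (hku' : N k u.rev = 0) : False := by
  obtain ⟨P, hPu, hag, -⟩ := servedBelow_of_zero C (hA.ruleD.1 N hN) hku' hjk (by rw [hjv1]; decide)
  have hPfc : FC P := hA.fc_of_agree (Or.inr hPu) hfc hj'k (fun r => hag j' r (fun h => hjj'.symm h.1))
    (fun r => hag k r (fun h => hjk.symm h.1))
  refine hA.b2_upper hR h2 hPu hPfc hj'k (v := v') (u := u) ?_ ?_ ?_ ?_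
  · rw [hag j' v' (fun h => hjj'.symm h.1)]; exact hj'v
  · rw [hag j' v'.rev (fun h => hjj'.symm h.1)]; exact hj'v1
  · rw [hag k u (fun h => hjk.symm h.1)]; exact hku
  · rw [hag k u.rev (fun h => hjk.symm h.1)]; exact hku'

/-- RULE D at an all-ray fully charged `P`-cell `Q` carrying the maximal ray `R` at `k`: every other factor's zero coordinate is served
antipodally-up (the own-up server of `k` and the covers through `k` would carry a ray of charge `> R`). -/
theorem Admissible.antiServer {Q : Cell} (hQu : Q ∈ C.upper) (hQfc : FC Q) {k : Fin 4} {wk : Fin 2} (hQk : Q k wk = R)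
    (hQk' : Q k wk.rev = 0) (hR0 : R ≠ 0) {m : Fin 4} (hmk : m ≠ k) {wm : Fin 2} (hQm : Q m wm.rev = 0) :
    ∃ N ∈ C.lower, Agree1 N Q m wm.rev ∧ Q m wm.rev < N m wm.rev := by
  obtain ⟨a, hak, ham, -⟩ := exists_fourth k m m
  obtain ⟨b, hbk, hbm, hba⟩ := exists_fourth k m a
  rcases hA.ruleD.2 Q hQu k m (Ne.symm hmk) wk wm.rev (by rw [hQk, hQm]; exact hR0) with
      ⟨N, hNl, hag, hlt⟩ | h | ⟨N, hNl, hag, hlt, -⟩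
  · have hNfc : FC N :=
      hA.fc_of_agree (Or.inl hNl) hQfc (Ne.symm hba) (fun r => hag a r (fun h => hak h.1)) (fun r => hag b r (fun h => hbk h.1))
    have := hR N (Or.inl hNl) hNfc k wk (by rw [hag k wk.rev (fun h => absurd h.2 (by fin_cases wk <;> decide))]; exact hQk')
    omega
  · exact h
  · have hNfc : FC N := hA.fc_of_agree (Or.inl hNl) hQfc (Ne.symm hba) (fun r => hag a r (fun h => hak h.1) (fun h => ham h.1))
      (fun r => hag b r (fun h => hbk h.1) (fun h => hbm h.1))
    have := hR N (Or.inl hNl) hNfc k wk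
      (by rw [hag k wk.rev (fun h => absurd h.2 (by fin_cases wk <;> decide)) (fun h => hmk.symm h.1)]; exact hQk')
    omega

/-- (B4)+(B5): an all-ray fully charged `P`-cell cannot carry a ray of the maximal charge `R ≥ 2`. (Antipodal-up servers `N_m`; an
`N` with two rays has ray charges `≥ 2`, so the charge next to `k` is `≥ 2` and `N_m`'s new letter is the tower `(c_m, 1)`; its own
coordinate is served below — by a `P` that is a tower next to the ray `R` (excluded), a bare node (not in `𝒰`), or the unit-ray FLIP
of `P` at `m`; RULE D at the flip against a third factor yields an `N` with two rays one of which is a unit ray — impossible.) -/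
theorem Admissible.b45 (h2 : 2 ≤ R) {P : Cell} (hPu : P ∈ C.upper) (hfc : FC P) (w : Fin 4 → Fin 2)
    (hray : ∀ m, P m (w m).rev = 0) {k : Fin 4} (hk : P k (w k) = R) : False := by
  have hR0 : R ≠ 0 := by omega
  obtain ⟨m, hmk, -⟩ := exists_fourth k k k
  obtain ⟨m', hm'k, hm'm, -⟩ := exists_fourth k m m
  -- the charge at m is ≥ 2 (the server of m' is an N with rays at k and m)
  have hcm : 2 ≤ P m (w m) := by
    obtain ⟨N, hNl, hag, -⟩ := hA.antiServer hR hPu hfc hk (hray k) hR0 hm'k (hray m')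
    have hNk : ∀ r, N k r = P k r := fun r => hag k r (fun h => hm'k.symm h.1)
    have hNm : ∀ r, N m r = P m r := fun r => hag m r (fun h => hm'm.symm h.1)
    have hNfc : FC N := hA.fc_of_agree (Or.inl hNl) hfc (Ne.symm hmk) hNk hNm
    have := hA.two_le_ray hNl hNfc (Ne.symm hmk) (u := w k) (u' := w m) (by rw [hNk]; exact hray k)
      (by rw [hNm]; exact fun h => hfc m (isO_of_sides (w m) h (hray m))) (by rw [hNm]; exact hray m)
    rw [hNm] at this; exact this
  -- the server N of m is the tower (c_m, 1)
  obtain ⟨N, hNl, hag, hlt⟩ := hA.antiServer hR hPu hfc hk (hray k) hR0 hmk (hray m)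
  have hNk : ∀ r, N k r = P k r := fun r => hag k r (fun h => hmk.symm h.1)
  have hNm' : ∀ r, N m' r = P m' r := fun r => hag m' r (fun h => hm'm h.1)
  have hNfc : FC N := hA.fc_of_agree (Or.inl hNl) hfc hm'k hNm' hNk
  have hNm : N m (w m) = P m (w m) := hag m (w m) (fun h => ne_rev _ h.2)
  have hNe : N m (w m).rev = 1 := by
    have hlt' : 0 < N m (w m).rev := by rw [hray m] at hlt; exact hlt
    rcases hA.uN N hNl m with h | h | ⟨hmin, -⟩
    · exfalso
      rcases (side01 (w m)).1 with e | e <;> rw [e] at h <;> omega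
    · exfalso
      rcases (side01 (w m)).2 with e | e <;> rw [e] at h <;> omega
    · rw [min_sides N m (w m)] at hmin; omega
  -- its own coordinate c_m is served below: tower next to R (excluded), bare node (not in 𝒰), or the unit-ray flip
  obtain ⟨P', hP'u, hag', -⟩ := servedBelow_of_zero C (hA.ruleD.1 N hNl) (f₀ := k) (r₀ := (w k).rev)
    (by rw [hNk]; exact hray k) hmk (g := m) (r := w m) (by rw [hNm]; omega)
  have hP'k : ∀ r, P' k r = P k r := fun r => by rw [hag' k r (fun h => hmk.symm h.1), hNk]
  have hP'm' : ∀ r, P' m' r = P m' r := fun r => by rw [hag' m' r (fun h => hm'm h.1), hNm']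
  have hP'fc : FC P' := hA.fc_of_agree (Or.inr hP'u) hfc hm'k hP'm' hP'k
  have hP'e : P' m (w m).rev = 1 := by rw [hag' m (w m).rev (fun h => ne_rev _ h.2.symm)]; exact hNe
  rcases Nat.lt_or_ge (P' m (w m)) 2 with hd | hd
  · rcases Nat.lt_or_ge (P' m (w m)) 1 with hd0 | hd1
    · -- the unit-ray flip: RULE D at it against m′ yields an N with the rays at k and the unit ray at m
      have hP'0 : P' m (w m) = 0 := by omega
      obtain ⟨N', hN'l, hag'', -⟩ := hA.antiServer hR hP'u hP'fc (wk := w k) (by rw [hP'k]; exact hk)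
        (by rw [hP'k]; exact hray k) hR0 hm'k (wm := w m') (by rw [hP'm']; exact hray m')
      have hN'k : ∀ r, N' k r = P' k r := fun r => hag'' k r (fun h => hm'k.symm h.1)
      have hN'm : ∀ r, N' m r = P' m r := fun r => hag'' m r (fun h => hm'm.symm h.1)
      have hN'fc : FC N' := hA.fc_of_agree (Or.inl hN'l) hP'fc (Ne.symm hmk) hN'k hN'm
      have := hA.two_le_ray hN'l hN'fc (Ne.symm hmk) (u := w k) (u' := (w m).rev)
        (by rw [hN'k, hP'k]; exact hray k) (by rw [hN'm, hP'e]; decide) (by rw [Fin.rev_rev, hN'm]; exact hP'0)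
      rw [hN'm, hP'e] at this; omega
    · -- bare node
      rcases hA.uP P' hP'u m with h | h | ⟨-, hmax⟩
      · rcases (side01 (w m)).1 with e | e <;> rw [e] at h <;> omega
      · rcases (side01 (w m)).2 with e | e <;> rw [e] at h <;> omega
      · rw [max_sides P' m (w m)] at hmax; omega
  · -- a tower next to the ray R
    exact hA.b2_upper hR h2 hP'u hP'fc hmk (v := w m) (u := w k) hd hP'e (by rw [hP'k]; exact hk) (by rw [hP'k]; exact hray k)

end B25

end Summit.Ventures.HSemireg.Pad4Tower
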